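import Summits.MatrixMultiplication.OmegaCensus.Z4Z4CubeTables
import HarnessLib

/-!
# Gaussian-integer tables for the domino shape with a part of size `5` over `A ↠ ℤ₄ × ℤ₄`

ω-census `pub-omega`, family (b3), seat pub-omega-group gen 15.  Framing: lottery ticket; floor = certified bounds/negative
ranges.  VALUE: kernel lemmas (finite tables by `decide`) feeding `DominoPartFiveZ4Z4.lean`; NOT progress on ω.

Setting (`Z4Z4Characters.lean`, `DominoPartThreeZ4Z4.lean`): a shifted domino form `(X+Y) ⊔ (β+(Y−X)) ⊔ (γ+(X−Y)) = A∖{x₀}`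
with `|X| = 5`, pushed along `φ : A ↠ ℤ₄²`, gives for every character `ψ = ψ_w` the identity
`a b + ψ(β) ā b + ψ(γ) a b̄ = −ψ(x₀)` (`a = ψ(X)`, `b = ψ(Y)`).  After translating by a point `x₁ ∈ X` and choosing
coordinates `w, w'` dual to `(φ(β − 2x₁), φγ)`, only the two characters `w` and `w + 2w'` are needed; for both `ψ(β') = i`,
and `ψ(γ) = ±1`.  Eliminating `b̄` (`det_mul_eq`) gives `D · b = N` with the INTEGER `D = x² + 4xy + y²` (`a = x + yi`) and
`N = (ā − i a) r − v a r̄`; so `N` must be divisible by `D` componentwise — `false_of_kill5`.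

* `pattern5`: the parity pattern of the other three points forced by the three real characters (each real character sum
  of the five points is `±1`): their classes mod `2` are `01, 10, 11` in some order (`decide`, `4 096` cases).
* `table5`: for the normalised exponent data (`x₁ ↦ 0`, `x₂ ≡ x₁`, classes `01 | 10 | 11`, `x₀` free) one of the two
  characters has `N` not divisible by `D` (`decide`, `4 096` instances, `256` surviving the hypotheses; found by exact
  enumeration, `pub-omega-group-g15/code/table5check.py`).
-/

namespace Summit.MatrixMultiplication.OmegaCensus

open Finset

/-! ## Small facts about powers of `i` -/

/-- `i^0 = 1` (exponent in `ZMod 4`). [folklore] -/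
theorem ipow_zmod_zero : (⟨0, 1⟩ : GaussianInt) ^ (0 : ZMod 4).val = 1 := by decide

/-- `i^1 = i` (exponent in `ZMod 4`). [folklore] -/
theorem ipow_zmod_one : (⟨0, 1⟩ : GaussianInt) ^ (1 : ZMod 4).val = (⟨0, 1⟩ : GaussianInt) := by decide

/-- `i^2 = −1` (exponent in `ZMod 4`). [folklore] -/
theorem ipow_zmod_two : (⟨0, 1⟩ : GaussianInt) ^ (2 : ZMod 4).val = -1 := by decide

/-- `i^(m + 2n) = i^m · i^(2n)` written with `n + n`. [folklore] -/
theorem ipow_add_two_mul (m n : ZMod 4) : (⟨0, 1⟩ : GaussianInt) ^ (m + 2 * n).val = (⟨0, 1⟩ : GaussianInt) ^ m.val * (⟨0, 1⟩ : GaussianInt) ^ (2 * n).val := ipow_add m (2 * n)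

/-- `2a ∈ {0, 2}` in `ZMod 4`, as membership in a four-element set of pairs (for the pigeonhole). [folklore] -/
theorem two_mul_pair_mem (q : ZMod 4 × ZMod 4) :
    ((2 * q.1, 2 * q.2) : ZMod 4 × ZMod 4) ∈ ({(0, 0), (0, 2), (2, 0), (2, 2)} : Finset (ZMod 4 × ZMod 4)) := by
  revert q; decide

/-- `2m = 0 ⇒ i^(2m)`-free form: `i^(m) = i^(m)` bookkeeping — if `2 n = 0` then `i^(m + 2n) = i^m`. [folklore] -/
theorem ipow_add_two_mul_of_eq_zero (m n : ZMod 4) (h : 2 * n = 0) : (⟨0, 1⟩ : GaussianInt) ^ (m + 2 * n).val = (⟨0, 1⟩ : GaussianInt) ^ m.val := by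
  rw [h, add_zero]

/-- If `2 n = 2` then `i^(m + 2n) = i^(m+2)`. [folklore] -/
theorem ipow_add_two_mul_of_eq_two (m n : ZMod 4) (h : 2 * n = 2) : (⟨0, 1⟩ : GaussianInt) ^ (m + 2 * n).val = (⟨0, 1⟩ : GaussianInt) ^ (m + 2).val := by
  rw [h]

/-- A unit of `ℤ[i]` (a power of `i`) is not divisible by `3`. [folklore] -/
theorem three_mul_ne_neg_ipow (c : GaussianInt) (m : ZMod 4) : 3 * c ≠ -(⟨0, 1⟩ : GaussianInt) ^ m.val := by
  intro h
  have := congrArg Zsqrtd.norm h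
  rw [Zsqrtd.norm_mul, Zsqrtd.norm_neg, norm_ipow] at this
  have h9 : (3 : GaussianInt).norm = 9 := by decide
  rw [h9] at this
  omega

/-- A unit of `ℤ[i]` is not divisible by `5`. [folklore] -/
theorem five_mul_ne_neg_ipow (c : GaussianInt) (m : ZMod 4) : 5 * c ≠ -(⟨0, 1⟩ : GaussianInt) ^ m.val := by
  intro h
  have := congrArg Zsqrtd.norm h
  rw [Zsqrtd.norm_mul, Zsqrtd.norm_neg, norm_ipow] at this
  have h25 : (5 : GaussianInt).norm = 25 := by decide
  rw [h25] at this
  omega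

/-! ## The divisibility obstruction -/

/-- **`D · b = N` with `D ∈ ℤ`: `N` is divisible by `D` componentwise.**  From `a b + i ā b + v a b̄ = r` with `v v̄ = 1`:
`D = (Re a)² + 4 Re a Im a + (Im a)²`, `N = (ā − i a) r − v a r̄`, and `N ≡ 0 (mod D)` in both coordinates; so a
certificate `N.re % D ≠ 0 ∨ N.im % D ≠ 0` is contradictory. [folklore] -/
theorem false_of_kill5 {a v r b : GaussianInt} (hv : v * star v = 1)
    (h : a * b + (⟨0, 1⟩ : GaussianInt) * star a * b + v * a * star b = r)
    (hk : ((star a - (⟨0, 1⟩ : GaussianInt) * a) * r - v * a * star r).re % (a.re * a.re + 4 * a.re * a.im + a.im * a.im) ≠ 0 ∨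
      ((star a - (⟨0, 1⟩ : GaussianInt) * a) * r - v * a * star r).im % (a.re * a.re + 4 * a.re * a.im + a.im * a.im) ≠ 0) : False := by
  have key := det_mul_eq (a + (⟨0, 1⟩ : GaussianInt) * star a) (v * a) r b (by linear_combination h)
  have hD : star (a + (⟨0, 1⟩ : GaussianInt) * star a) * (a + (⟨0, 1⟩ : GaussianInt) * star a) - v * a * star (v * a) =
      ⟨a.re * a.re + 4 * a.re * a.im + a.im * a.im, 0⟩ := by
    have e1 : star (a + (⟨0, 1⟩ : GaussianInt) * star a) * (a + (⟨0, 1⟩ : GaussianInt) * star a) - v * a * star (v * a) =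
        star a * a + star a * (⟨0, 1⟩ : GaussianInt) * star a + star (⟨0, 1⟩ : GaussianInt) * a * a + star (⟨0, 1⟩ : GaussianInt) * (⟨0, 1⟩ : GaussianInt) * (a * star a) - (v * star v) * (a * star a) := by
      simp only [star_add, star_mul, star_star]; ring
    rw [e1, hv]
    apply Zsqrtd.ext <;> simp <;> ring
  have hp : star (a + (⟨0, 1⟩ : GaussianInt) * star a) = star a - (⟨0, 1⟩ : GaussianInt) * a := by
    simp only [star_add, star_mul, star_star]
    apply Zsqrtd.ext
    · simp
    · simp; ring
  rw [hD, hp] at key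
  set N := (star a - (⟨0, 1⟩ : GaussianInt) * a) * r - v * a * star r with hN
  set D : ℤ := a.re * a.re + 4 * a.re * a.im + a.im * a.im with hDd
  have hre : N.re = D * b.re := by rw [← key]; simp
  have him : N.im = D * b.im := by rw [← key]; simp
  rcases hk with hk | hk
  · exact hk (by rw [hre, Int.mul_emod_right])
  · exact hk (by rw [him, Int.mul_emod_right])

/-! ## The parity pattern of the five points -/

set_option synthInstance.maxHeartbeats 400000 in
set_option synthInstance.maxSize 4096 in
/-- **Pattern lemma.**  Exponent pairs `(m₃,n₃), (m₄,n₄), (m₅,n₅)` (the three points other than the coincident pair, in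
coordinates `w, w'`) such that for each of the three real characters `2w, 2w', 2(w+w')` no two of the three values are `1`:
their classes mod `2` are `01, 10, 11` in some order. [folklore] -/
theorem pattern5 : ∀ m₃ n₃ m₄ n₄ m₅ n₅ : ZMod 4,
    ¬ ((⟨0, 1⟩ : GaussianInt) ^ (2 * m₃).val = 1 ∧ (⟨0, 1⟩ : GaussianInt) ^ (2 * m₄).val = 1) → ¬ ((⟨0, 1⟩ : GaussianInt) ^ (2 * m₃).val = 1 ∧ (⟨0, 1⟩ : GaussianInt) ^ (2 * m₅).val = 1) →
    ¬ ((⟨0, 1⟩ : GaussianInt) ^ (2 * m₄).val = 1 ∧ (⟨0, 1⟩ : GaussianInt) ^ (2 * m₅).val = 1) →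
    ¬ ((⟨0, 1⟩ : GaussianInt) ^ (2 * n₃).val = 1 ∧ (⟨0, 1⟩ : GaussianInt) ^ (2 * n₄).val = 1) → ¬ ((⟨0, 1⟩ : GaussianInt) ^ (2 * n₃).val = 1 ∧ (⟨0, 1⟩ : GaussianInt) ^ (2 * n₅).val = 1) →
    ¬ ((⟨0, 1⟩ : GaussianInt) ^ (2 * n₄).val = 1 ∧ (⟨0, 1⟩ : GaussianInt) ^ (2 * n₅).val = 1) →
    ¬ ((⟨0, 1⟩ : GaussianInt) ^ (2 * (m₃ + n₃)).val = 1 ∧ (⟨0, 1⟩ : GaussianInt) ^ (2 * (m₄ + n₄)).val = 1) →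
    ¬ ((⟨0, 1⟩ : GaussianInt) ^ (2 * (m₃ + n₃)).val = 1 ∧ (⟨0, 1⟩ : GaussianInt) ^ (2 * (m₅ + n₅)).val = 1) →
    ¬ ((⟨0, 1⟩ : GaussianInt) ^ (2 * (m₄ + n₄)).val = 1 ∧ (⟨0, 1⟩ : GaussianInt) ^ (2 * (m₅ + n₅)).val = 1) →
    (2 * m₃ = 0 ∧ 2 * n₃ = 2 ∧ 2 * m₄ = 2 ∧ 2 * n₄ = 0 ∧ 2 * m₅ = 2 ∧ 2 * n₅ = 2) ∨
    (2 * m₃ = 0 ∧ 2 * n₃ = 2 ∧ 2 * m₅ = 2 ∧ 2 * n₅ = 0 ∧ 2 * m₄ = 2 ∧ 2 * n₄ = 2) ∨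
    (2 * m₄ = 0 ∧ 2 * n₄ = 2 ∧ 2 * m₃ = 2 ∧ 2 * n₃ = 0 ∧ 2 * m₅ = 2 ∧ 2 * n₅ = 2) ∨
    (2 * m₄ = 0 ∧ 2 * n₄ = 2 ∧ 2 * m₅ = 2 ∧ 2 * n₅ = 0 ∧ 2 * m₃ = 2 ∧ 2 * n₃ = 2) ∨
    (2 * m₅ = 0 ∧ 2 * n₅ = 2 ∧ 2 * m₃ = 2 ∧ 2 * n₃ = 0 ∧ 2 * m₄ = 2 ∧ 2 * n₄ = 2) ∨
    (2 * m₅ = 0 ∧ 2 * n₅ = 2 ∧ 2 * m₄ = 2 ∧ 2 * n₄ = 0 ∧ 2 * m₃ = 2 ∧ 2 * n₃ = 2) := by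
  decide

/-! ## The two-character table -/

/-- **The table** (`decide`; `4 096` instances, `256` past the hypotheses).  Normalised exponent data of the five points in
coordinates `w` (`m`'s; the point `x₁` has exponent `0`, `x₂ ≡ x₁` has `2m₂ = 0`, the classes of the other three are
`01 | 10 | 11`) and of `x₀ − x₁` (`l₁ = ⟨w,·⟩`, `l₂ = ⟨w',·⟩`): for the character `w` (`ψβ' = i`, `ψγ = 1`) or the character
`w + 2w'` (exponents shifted by twice the `w'`-classes, `ψβ' = i`, `ψγ = −1`, `ψ(x₀−x₁) = i^(l₁+2l₂)`), the quantity `N` of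
`false_of_kill5` is not divisible by `D`. [folklore] -/
theorem table5 : ∀ m₂ m₃ m₄ m₅ l₁ l₂ : ZMod 4, 2 * m₂ = 0 → 2 * m₃ = 0 → 2 * m₄ = 2 → 2 * m₅ = 2 →
    (((star (1 + (⟨0, 1⟩ : GaussianInt) ^ m₂.val + (⟨0, 1⟩ : GaussianInt) ^ m₃.val + (⟨0, 1⟩ : GaussianInt) ^ m₄.val + (⟨0, 1⟩ : GaussianInt) ^ m₅.val) -
            (⟨0, 1⟩ : GaussianInt) * (1 + (⟨0, 1⟩ : GaussianInt) ^ m₂.val + (⟨0, 1⟩ : GaussianInt) ^ m₃.val + (⟨0, 1⟩ : GaussianInt) ^ m₄.val + (⟨0, 1⟩ : GaussianInt) ^ m₅.val)) * (-(⟨0, 1⟩ : GaussianInt) ^ l₁.val) -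
          1 * (1 + (⟨0, 1⟩ : GaussianInt) ^ m₂.val + (⟨0, 1⟩ : GaussianInt) ^ m₃.val + (⟨0, 1⟩ : GaussianInt) ^ m₄.val + (⟨0, 1⟩ : GaussianInt) ^ m₅.val) * star (-(⟨0, 1⟩ : GaussianInt) ^ l₁.val)).re %
        ((1 + (⟨0, 1⟩ : GaussianInt) ^ m₂.val + (⟨0, 1⟩ : GaussianInt) ^ m₃.val + (⟨0, 1⟩ : GaussianInt) ^ m₄.val + (⟨0, 1⟩ : GaussianInt) ^ m₅.val).re *
            (1 + (⟨0, 1⟩ : GaussianInt) ^ m₂.val + (⟨0, 1⟩ : GaussianInt) ^ m₃.val + (⟨0, 1⟩ : GaussianInt) ^ m₄.val + (⟨0, 1⟩ : GaussianInt) ^ m₅.val).re +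
          4 * (1 + (⟨0, 1⟩ : GaussianInt) ^ m₂.val + (⟨0, 1⟩ : GaussianInt) ^ m₃.val + (⟨0, 1⟩ : GaussianInt) ^ m₄.val + (⟨0, 1⟩ : GaussianInt) ^ m₅.val).re *
            (1 + (⟨0, 1⟩ : GaussianInt) ^ m₂.val + (⟨0, 1⟩ : GaussianInt) ^ m₃.val + (⟨0, 1⟩ : GaussianInt) ^ m₄.val + (⟨0, 1⟩ : GaussianInt) ^ m₅.val).im +
          (1 + (⟨0, 1⟩ : GaussianInt) ^ m₂.val + (⟨0, 1⟩ : GaussianInt) ^ m₃.val + (⟨0, 1⟩ : GaussianInt) ^ m₄.val + (⟨0, 1⟩ : GaussianInt) ^ m₅.val).im *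
            (1 + (⟨0, 1⟩ : GaussianInt) ^ m₂.val + (⟨0, 1⟩ : GaussianInt) ^ m₃.val + (⟨0, 1⟩ : GaussianInt) ^ m₄.val + (⟨0, 1⟩ : GaussianInt) ^ m₅.val).im) ≠ 0 ∨
      ((star (1 + (⟨0, 1⟩ : GaussianInt) ^ m₂.val + (⟨0, 1⟩ : GaussianInt) ^ m₃.val + (⟨0, 1⟩ : GaussianInt) ^ m₄.val + (⟨0, 1⟩ : GaussianInt) ^ m₅.val) -
            (⟨0, 1⟩ : GaussianInt) * (1 + (⟨0, 1⟩ : GaussianInt) ^ m₂.val + (⟨0, 1⟩ : GaussianInt) ^ m₃.val + (⟨0, 1⟩ : GaussianInt) ^ m₄.val + (⟨0, 1⟩ : GaussianInt) ^ m₅.val)) * (-(⟨0, 1⟩ : GaussianInt) ^ l₁.val) -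
          1 * (1 + (⟨0, 1⟩ : GaussianInt) ^ m₂.val + (⟨0, 1⟩ : GaussianInt) ^ m₃.val + (⟨0, 1⟩ : GaussianInt) ^ m₄.val + (⟨0, 1⟩ : GaussianInt) ^ m₅.val) * star (-(⟨0, 1⟩ : GaussianInt) ^ l₁.val)).im %
        ((1 + (⟨0, 1⟩ : GaussianInt) ^ m₂.val + (⟨0, 1⟩ : GaussianInt) ^ m₃.val + (⟨0, 1⟩ : GaussianInt) ^ m₄.val + (⟨0, 1⟩ : GaussianInt) ^ m₅.val).re *
            (1 + (⟨0, 1⟩ : GaussianInt) ^ m₂.val + (⟨0, 1⟩ : GaussianInt) ^ m₃.val + (⟨0, 1⟩ : GaussianInt) ^ m₄.val + (⟨0, 1⟩ : GaussianInt) ^ m₅.val).re +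
          4 * (1 + (⟨0, 1⟩ : GaussianInt) ^ m₂.val + (⟨0, 1⟩ : GaussianInt) ^ m₃.val + (⟨0, 1⟩ : GaussianInt) ^ m₄.val + (⟨0, 1⟩ : GaussianInt) ^ m₅.val).re *
            (1 + (⟨0, 1⟩ : GaussianInt) ^ m₂.val + (⟨0, 1⟩ : GaussianInt) ^ m₃.val + (⟨0, 1⟩ : GaussianInt) ^ m₄.val + (⟨0, 1⟩ : GaussianInt) ^ m₅.val).im +
          (1 + (⟨0, 1⟩ : GaussianInt) ^ m₂.val + (⟨0, 1⟩ : GaussianInt) ^ m₃.val + (⟨0, 1⟩ : GaussianInt) ^ m₄.val + (⟨0, 1⟩ : GaussianInt) ^ m₅.val).im *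
            (1 + (⟨0, 1⟩ : GaussianInt) ^ m₂.val + (⟨0, 1⟩ : GaussianInt) ^ m₃.val + (⟨0, 1⟩ : GaussianInt) ^ m₄.val + (⟨0, 1⟩ : GaussianInt) ^ m₅.val).im) ≠ 0) ∨
    (((star (1 + (⟨0, 1⟩ : GaussianInt) ^ m₂.val + (⟨0, 1⟩ : GaussianInt) ^ (m₃ + 2).val + (⟨0, 1⟩ : GaussianInt) ^ m₄.val + (⟨0, 1⟩ : GaussianInt) ^ (m₅ + 2).val) -
            (⟨0, 1⟩ : GaussianInt) * (1 + (⟨0, 1⟩ : GaussianInt) ^ m₂.val + (⟨0, 1⟩ : GaussianInt) ^ (m₃ + 2).val + (⟨0, 1⟩ : GaussianInt) ^ m₄.val + (⟨0, 1⟩ : GaussianInt) ^ (m₅ + 2).val)) * (-(⟨0, 1⟩ : GaussianInt) ^ (l₁ + 2 * l₂).val) -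
          (-1) * (1 + (⟨0, 1⟩ : GaussianInt) ^ m₂.val + (⟨0, 1⟩ : GaussianInt) ^ (m₃ + 2).val + (⟨0, 1⟩ : GaussianInt) ^ m₄.val + (⟨0, 1⟩ : GaussianInt) ^ (m₅ + 2).val) *
            star (-(⟨0, 1⟩ : GaussianInt) ^ (l₁ + 2 * l₂).val)).re %
        ((1 + (⟨0, 1⟩ : GaussianInt) ^ m₂.val + (⟨0, 1⟩ : GaussianInt) ^ (m₃ + 2).val + (⟨0, 1⟩ : GaussianInt) ^ m₄.val + (⟨0, 1⟩ : GaussianInt) ^ (m₅ + 2).val).re *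
            (1 + (⟨0, 1⟩ : GaussianInt) ^ m₂.val + (⟨0, 1⟩ : GaussianInt) ^ (m₃ + 2).val + (⟨0, 1⟩ : GaussianInt) ^ m₄.val + (⟨0, 1⟩ : GaussianInt) ^ (m₅ + 2).val).re +
          4 * (1 + (⟨0, 1⟩ : GaussianInt) ^ m₂.val + (⟨0, 1⟩ : GaussianInt) ^ (m₃ + 2).val + (⟨0, 1⟩ : GaussianInt) ^ m₄.val + (⟨0, 1⟩ : GaussianInt) ^ (m₅ + 2).val).re *
            (1 + (⟨0, 1⟩ : GaussianInt) ^ m₂.val + (⟨0, 1⟩ : GaussianInt) ^ (m₃ + 2).val + (⟨0, 1⟩ : GaussianInt) ^ m₄.val + (⟨0, 1⟩ : GaussianInt) ^ (m₅ + 2).val).im +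
          (1 + (⟨0, 1⟩ : GaussianInt) ^ m₂.val + (⟨0, 1⟩ : GaussianInt) ^ (m₃ + 2).val + (⟨0, 1⟩ : GaussianInt) ^ m₄.val + (⟨0, 1⟩ : GaussianInt) ^ (m₅ + 2).val).im *
            (1 + (⟨0, 1⟩ : GaussianInt) ^ m₂.val + (⟨0, 1⟩ : GaussianInt) ^ (m₃ + 2).val + (⟨0, 1⟩ : GaussianInt) ^ m₄.val + (⟨0, 1⟩ : GaussianInt) ^ (m₅ + 2).val).im) ≠ 0 ∨
      ((star (1 + (⟨0, 1⟩ : GaussianInt) ^ m₂.val + (⟨0, 1⟩ : GaussianInt) ^ (m₃ + 2).val + (⟨0, 1⟩ : GaussianInt) ^ m₄.val + (⟨0, 1⟩ : GaussianInt) ^ (m₅ + 2).val) -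
            (⟨0, 1⟩ : GaussianInt) * (1 + (⟨0, 1⟩ : GaussianInt) ^ m₂.val + (⟨0, 1⟩ : GaussianInt) ^ (m₃ + 2).val + (⟨0, 1⟩ : GaussianInt) ^ m₄.val + (⟨0, 1⟩ : GaussianInt) ^ (m₅ + 2).val)) * (-(⟨0, 1⟩ : GaussianInt) ^ (l₁ + 2 * l₂).val) -
          (-1) * (1 + (⟨0, 1⟩ : GaussianInt) ^ m₂.val + (⟨0, 1⟩ : GaussianInt) ^ (m₃ + 2).val + (⟨0, 1⟩ : GaussianInt) ^ m₄.val + (⟨0, 1⟩ : GaussianInt) ^ (m₅ + 2).val) *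
            star (-(⟨0, 1⟩ : GaussianInt) ^ (l₁ + 2 * l₂).val)).im %
        ((1 + (⟨0, 1⟩ : GaussianInt) ^ m₂.val + (⟨0, 1⟩ : GaussianInt) ^ (m₃ + 2).val + (⟨0, 1⟩ : GaussianInt) ^ m₄.val + (⟨0, 1⟩ : GaussianInt) ^ (m₅ + 2).val).re *
            (1 + (⟨0, 1⟩ : GaussianInt) ^ m₂.val + (⟨0, 1⟩ : GaussianInt) ^ (m₃ + 2).val + (⟨0, 1⟩ : GaussianInt) ^ m₄.val + (⟨0, 1⟩ : GaussianInt) ^ (m₅ + 2).val).re +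
          4 * (1 + (⟨0, 1⟩ : GaussianInt) ^ m₂.val + (⟨0, 1⟩ : GaussianInt) ^ (m₃ + 2).val + (⟨0, 1⟩ : GaussianInt) ^ m₄.val + (⟨0, 1⟩ : GaussianInt) ^ (m₅ + 2).val).re *
            (1 + (⟨0, 1⟩ : GaussianInt) ^ m₂.val + (⟨0, 1⟩ : GaussianInt) ^ (m₃ + 2).val + (⟨0, 1⟩ : GaussianInt) ^ m₄.val + (⟨0, 1⟩ : GaussianInt) ^ (m₅ + 2).val).im +
          (1 + (⟨0, 1⟩ : GaussianInt) ^ m₂.val + (⟨0, 1⟩ : GaussianInt) ^ (m₃ + 2).val + (⟨0, 1⟩ : GaussianInt) ^ m₄.val + (⟨0, 1⟩ : GaussianInt) ^ (m₅ + 2).val).im *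
            (1 + (⟨0, 1⟩ : GaussianInt) ^ m₂.val + (⟨0, 1⟩ : GaussianInt) ^ (m₃ + 2).val + (⟨0, 1⟩ : GaussianInt) ^ m₄.val + (⟨0, 1⟩ : GaussianInt) ^ (m₅ + 2).val).im) ≠ 0) := by
  decide

end Summit.MatrixMultiplication.OmegaCensus
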